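import Mathlib.Topology.Instances.ZMod
import Mathlib.Topology.Algebra.Group.Basic
import Mathlib.Data.ZMod.Basic
import Literature.AnabelianGeometry.AbsoluteAnabelian.AbsTopII.EllipticCuspidalizationTF
import Literature.AnabelianGeometry.AbsoluteAnabelian.AbsTopII.EllipticCuspidalizationNonVacuity
import HarnessLib

/-!
# [AbsTopII] Cor 3.3 (ii), PRINT-FAITHFUL successor `Cor_3_3_iiTF`: SCHEMA bookkeeping in the kernel
# — the universal closure is FALSE (counter-model), the instance form HOLDS (non-vacuous model), and
# the successor output structure `EllipticCuspidalizationTF` is inhabited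

S. Mochizuki, *Topics in Absolute Anabelian Geometry II: Decomposition Groups and Endomorphisms*
[AbsTopII] (bib `MochizukiAbsTopII2013`; kurims manuscript `paper:url-585b8d0ad0d9`, cell render
`HOME/lit/renders/AbsTopII-kurims-url-585b8d0ad0d9/p0068.txt`), §3, Corollary 3.3 (ii) p. 68:
"… the collection of open subgroups `J ⊆ Π_C` of index `2` such that `J ∩ Δ_C` [where
`Δ_C := Ker(Π_C ↠ G')`] is torsion-free [i.e., the covering determined by `J` is a scheme — cf.
[AbsTopI], Lemma 4.1, (iv)]."

PROOF-ONLY file (cell abc-iut, row «TORSIONFREE-SUCCESSOR», abc-iut-L4-lead m151 (6) / m156 (2);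
seat abc-iut-L4-t4 gen 12; answers RQ7 INFO ii of abc-iut-L4-t11 on p495600: "a one-line
`exists_cor_3_3_iiTF_model` would make the successor row's INSTANCE FORM kernel-visible").  For the
predecessor schema `Cor_3_3_ii` (FACT-LIST F-0234) the tree holds abc-iut-L4-t6's counter-model
`exists_not_cor_3_3_ii` (`EllipticAdmissibleClosures.lean`) and instance `exists_cor_3_3_ii_model`
(`EllipticAdmissibleNonVacuity.lean`); both constructions are sealed inside their proofs, so the
successor `Cor_3_3_iiTF` (p494905) gets its own toy models here, in the same style (`Curve = Bool`,
one finite étale morphism `true → false`, trivial Galois groups, finite discrete `Π`):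
* `exists_not_cor_3_3_iiTF` / `not_forall_cor_3_3_iiTF` — `Π_true = ℤ/2 ↪ Π_false = ℤ/2 × ℤ/2`
  (first factor): `false` is semi-elliptic as typed, but `Π_true ∩ Δ_false = Π_true` contains the
  element `(g, 1)` of order `2`, so `Π_true` is not in the print-faithful right-hand side either — the
  universal closure of the successor schema is FALSE (as for the predecessor);
* `exists_cor_3_3_iiTF_model` — `Π_true = 1 ↪ Π_false = ℤ/2`: `false` is semi-elliptic as typed and
  BOTH sides of the successor equation are `{1}` (the unique subgroup of index `2` of `ℤ/2`; the
  trivial group has no nontrivial element of finite order) — the instance form HOLDS, non-vacuously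
  (some curve is semi-elliptic);
* `EllipticCuspidalizationTF.exists_nonempty_degenerate` — the successor OUTPUT structure (p495802)
  is inhabited (image under `EllipticCuspidalization.toTF` of abc-iut's degenerate finite witness
  `EllipticCuspidalization.exists_nonempty_degenerate`).

HONEST FRAMING: toy (counter-)models of OUR abstract schema; they say nothing about hyperbolic
orbicurves, nothing about [AbsTopII] Cor 3.3 (ii) itself (a refereed, published theorem), and
nothing about [IUTchIII] Cor 3.12; no side taken; typed ≠ proved for the geometric instance.  No
`def`, no instance; axioms standard.
-/

namespace Literature.AnabelianGeometry.AbsoluteAnabelian.AbsTopII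

open FundamentalExtension

/-! ### The universal closure of the successor schema is false -/

/-- **The successor schema `Cor_3_3_iiTF` fails at some isogeny-level model** (kernel
counter-model, the predecessor's one re-read print-faithfully): `Curve = Bool`, `Π_true = ℤ/2`,
`Π_false = ℤ/2 × ℤ/2`, trivial Galois groups, one finite étale morphism `true → false` inducing
`a ↦ (a, 1)`; `false` is semi-elliptic as typed but `Π_true ∩ Δ_false = Π_true` contains `(g, 1)` of
order `2`, so `Π_true ∉ semiEllipticDoubleCoverSubgroupsTF Π_false`.
[cite: MochizukiAbsTopII2013, Cor 3.3 (ii) p.68] -/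
theorem exists_not_cor_3_3_iiTF : ∃ M : IsogenyModel.{0}, ¬ Cor_3_3_iiTF M := by
  classical
  -- the groups: `A = ℤ/2` (multiplicatively, discrete) and the trivial Galois group
  let A : Type := Multiplicative (ZMod 2)
  let G₁ : Type := PUnit.{1}
  -- the two extensions `Π_D = A ↠ 1`, `Π_C = A × A ↠ 1`
  let E₁ : FundamentalExtension.{0} :=
    ⟨ProfiniteGrp.of A, ProfiniteGrp.of G₁, 1, fun _ => ⟨1, Subsingleton.elim _ _⟩⟩
  let E₂ : FundamentalExtension.{0} :=
    ⟨ProfiniteGrp.of (A × A), ProfiniteGrp.of G₁, 1, fun _ => ⟨1, Subsingleton.elim _ _⟩⟩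
  -- the morphism of extensions induced by `D → C`: first-factor inclusion on `Π`, identity on `G`
  let φ : E₁ ⟶ E₂ :=
    ⟨ContinuousMonoidHom.inl A A, ContinuousMonoidHom.id _, fun _ => Subsingleton.elim _ _⟩
  have hinl : ∀ a : A, φ.arith a = (a, (1 : A)) := fun _ => rfl
  have hinj : Function.Injective φ.arith := fun a b h => by
    have h' := congrArg Prod.fst h
    rwa [hinl, hinl] at h'
  have hdisc₂ : DiscreteTopology E₂.arith := inferInstanceAs (DiscreteTopology (A × A))
  have hφ : φ.IsOpenInjective :=
    { arith_injective := hinj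
      isOpen_range_arith := isOpen_discrete _
      gal_injective := fun _ _ _ => Subsingleton.elim _ _
      isOpen_range_gal := by
        rw [show Set.range φ.gal = Set.univ from Set.range_eq_univ.mpr fun x => ⟨x, rfl⟩]
        exact isOpen_univ }
  -- the model
  let M : IsogenyModel.{0} :=
    { Curve := Bool
      ext := fun b => cond b E₁ E₂
      FinEt := fun Y X => PLift (Y = true ∧ X = false)
      extMap := fun {Y X} f =>
        match Y, X, f with
        | true, false, _ => φ
        | false, _, ⟨h⟩ => absurd h.1 Bool.false_ne_true
        | true, true, ⟨h⟩ => absurd h.2.symm Bool.false_ne_true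
      extMap_isOpenInjective := fun {Y X} f =>
        match Y, X, f with
        | true, false, _ => hφ
        | false, _, ⟨h⟩ => absurd h.1 Bool.false_ne_true
        | true, true, ⟨h⟩ => absurd h.2.symm Bool.false_ne_true
      IsScheme := fun b => b = true
      genus := fun _ => 1
      cuspCard := fun _ => 1
      IsDefinedOverNF := fun _ => True }
  -- the double covering `D → C` of the model
  let f : M.FinEt true false := ⟨⟨rfl, rfl⟩⟩
  have hext : M.extMap f = φ := rfl
  have hJ : M.arithImage f = φ.arith.toMonoidHom.range := rfl
  -- `[Π_C : Π_D] = 2`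
  have hcardA : Nat.card A = 2 := by
    simp [A, Nat.card_eq_fintype_card]
  have hcardAA : Nat.card (A × A) = 4 := by
    rw [Nat.card_prod, hcardA]
  have hcardJ : Nat.card (φ.arith.toMonoidHom.range) = 2 :=
    (Nat.card_congr (MonoidHom.ofInjective hinj).toEquiv).symm.trans hcardA
  have hindex : (φ.arith.toMonoidHom.range).index = 2 := by
    have h := (φ.arith.toMonoidHom.range).card_mul_index
    rw [hcardJ] at h
    have h4 : Nat.card E₂.arith = 4 := hcardAA
    rw [h4] at h
    omega
  have hdeg : M.degree f = 2 := by
    show (M.arithImage f).index = 2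
    rw [hJ]
    exact hindex
  have hover : M.IsOver f := by
    show Function.Bijective (M.extMap f).gal
    rw [hext]
    exact ⟨hφ.gal_injective, fun x => ⟨x, rfl⟩⟩
  -- `C = false` is semi-elliptic as typed
  have hsemi : M.IsSemiElliptic false :=
    ⟨Bool.false_ne_true, true, f, hover, ⟨rfl, rfl, rfl⟩, hdeg⟩
  -- but `Π_D ∩ Δ_C = Π_D` has `2`-torsion: the element `(g, 1)`, `g` the generator of `ℤ/2`
  let g : A := Multiplicative.ofAdd (1 : ZMod 2)
  have hg1 : g ≠ 1 := by decide
  have hg2 : g ^ 2 = 1 := by decide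
  have hgeom : ∀ x : E₂.arith, x ∈ E₂.geom := fun x => Subsingleton.elim _ _
  have hnot : M.arithImage f ∉ semiEllipticDoubleCoverSubgroupsTF (M.ext false) := by
    rintro ⟨-, -, htf⟩
    have hmem : ((g, (1 : A)) : E₂.arith) ∈ M.arithImage f ⊓ (M.ext false).geom :=
      ⟨⟨g, hinl g⟩, hgeom _⟩
    let y : ↥(M.arithImage f ⊓ (M.ext false).geom) := ⟨(g, 1), hmem⟩
    have hx2 : ((g, (1 : A)) : A × A) ^ 2 = 1 := by
      rw [Prod.pow_mk, hg2, one_pow]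
      rfl
    have hy2 : y ^ 2 = 1 := Subtype.ext hx2
    have hy : y = 1 := htf y (isOfFinOrder_iff_pow_eq_one.mpr ⟨2, two_pos, hy2⟩)
    exact hg1 (congrArg (fun z => z.1.1) hy)
  -- whereas `Cor_3_3_iiTF M` would put it in that set
  refine ⟨M, fun hM => hnot ?_⟩
  have hEq : M.ellipticDoubleCoverImages false = semiEllipticDoubleCoverSubgroupsTF (M.ext false) :=
    hM false hsemi
  rw [← hEq]
  exact ⟨true, f, hover, ⟨rfl, rfl, rfl⟩, hdeg, rfl⟩

/-- **The universal closure of the successor schema `Cor_3_3_iiTF` is false** — like its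
predecessor it is a SCHEMA over the isogeny-level model interface, to be consumed BY NAME at the
intended (étale-`π₁`) model: `¬ ∀ M, Cor_3_3_iiTF M`.  Says nothing about the published theorem.
[cite: MochizukiAbsTopII2013, Cor 3.3 (ii) p.68] -/
theorem not_forall_cor_3_3_iiTF : ¬ ∀ M : IsogenyModel.{0}, Cor_3_3_iiTF M := by
  obtain ⟨M, hM⟩ := exists_not_cor_3_3_iiTF
  exact fun h => hM (h M)

/-! ### The instance form of the successor schema holds, non-vacuously -/

/-- **Instance form of the successor `Cor_3_3_iiTF`** (print-faithful successor of F-0234): the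
schema HOLDS at some isogeny-level model in which its hypothesis is met (some curve is semi-elliptic
as typed) — `Π_true = 1 ↪ Π_false = ℤ/2`, trivial Galois groups: both sides of the equation at
`false` are `{1}`, the unique subgroup of index `2` of `ℤ/2` (the trivial group has no nontrivial
element of finite order).  Toy model; says nothing about the published theorem.
[cite: MochizukiAbsTopII2013, Cor 3.3 (ii) p.68] -/
theorem exists_cor_3_3_iiTF_model :
    ∃ M : IsogenyModel.{0}, (∃ C : M.Curve, M.IsSemiElliptic C) ∧ Cor_3_3_iiTF M := by
  classical
  -- the groups: `A = ℤ/2` (multiplicatively, discrete) and the trivial group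
  let A : Type := Multiplicative (ZMod 2)
  let G₁ : Type := PUnit.{1}
  -- the two extensions `Π_D = 1 ↠ 1`, `Π_C = A ↠ 1`
  let E₁ : FundamentalExtension.{0} :=
    ⟨ProfiniteGrp.of G₁, ProfiniteGrp.of G₁, 1, fun _ => ⟨1, Subsingleton.elim _ _⟩⟩
  let E₂ : FundamentalExtension.{0} :=
    ⟨ProfiniteGrp.of A, ProfiniteGrp.of G₁, 1, fun _ => ⟨1, Subsingleton.elim _ _⟩⟩
  -- the morphism of extensions induced by `D → C`: the trivial inclusion on `Π`, identity on `G`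
  let φ : E₁ ⟶ E₂ := ⟨1, ContinuousMonoidHom.id _, fun _ => Subsingleton.elim _ _⟩
  have hinj : Function.Injective φ.arith := fun _ _ _ => Subsingleton.elim _ _
  have hdisc₂ : DiscreteTopology E₂.arith := inferInstanceAs (DiscreteTopology A)
  have hφ : φ.IsOpenInjective :=
    { arith_injective := hinj
      isOpen_range_arith := isOpen_discrete _
      gal_injective := fun _ _ _ => Subsingleton.elim _ _
      isOpen_range_gal := by
        rw [show Set.range φ.gal = Set.univ from Set.range_eq_univ.mpr fun x => ⟨x, rfl⟩]
        exact isOpen_univ }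
  -- the model
  let M : IsogenyModel.{0} :=
    { Curve := Bool
      ext := fun b => cond b E₁ E₂
      FinEt := fun Y X => PLift (Y = true ∧ X = false)
      extMap := fun {Y X} f =>
        match Y, X, f with
        | true, false, _ => φ
        | false, _, ⟨h⟩ => absurd h.1 Bool.false_ne_true
        | true, true, ⟨h⟩ => absurd h.2.symm Bool.false_ne_true
      extMap_isOpenInjective := fun {Y X} f =>
        match Y, X, f with
        | true, false, _ => hφ
        | false, _, ⟨h⟩ => absurd h.1 Bool.false_ne_true
        | true, true, ⟨h⟩ => absurd h.2.symm Bool.false_ne_true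
      IsScheme := fun b => b = true
      genus := fun _ => 1
      cuspCard := fun _ => 1
      IsDefinedOverNF := fun _ => True }
  -- the double covering `D → C` of the model; its `Π_D ⊆ Π_C` is the trivial subgroup
  let f : M.FinEt true false := ⟨⟨rfl, rfl⟩⟩
  have hext : M.extMap f = φ := rfl
  have hrange : φ.arith.toMonoidHom.range = ⊥ := by
    rw [eq_bot_iff]
    rintro x ⟨y, rfl⟩
    exact Subgroup.mem_bot.mpr rfl
  have hJ : M.arithImage f = ⊥ := hrange
  -- `[Π_C : Π_D] = 2`
  have hcardA : Nat.card A = 2 := by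
    simp [A, Nat.card_eq_fintype_card]
  have hindex_bot : (⊥ : Subgroup E₂.arith).index = 2 := by
    rw [Subgroup.index_bot]
    exact hcardA
  have hdeg : M.degree f = 2 := by
    show (M.arithImage f).index = 2
    rw [hJ]
    exact hindex_bot
  have hover : M.IsOver f := by
    show Function.Bijective (M.extMap f).gal
    rw [hext]
    exact ⟨hφ.gal_injective, fun x => ⟨x, rfl⟩⟩
  -- `C = false` is semi-elliptic as typed
  have hsemi : M.IsSemiElliptic false :=
    ⟨Bool.false_ne_true, true, f, hover, ⟨rfl, rfl, rfl⟩, hdeg⟩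
  -- every subgroup of index `2` of `Π_C = ℤ/2` is trivial
  have hidx2 : ∀ J : Subgroup E₂.arith, J.index = 2 → J = ⊥ := by
    intro J hJ2
    have h := J.card_mul_index
    rw [hJ2, show Nat.card E₂.arith = 2 from hcardA] at h
    have hcard : Nat.card J = 1 := by omega
    exact Subgroup.eq_bot_of_card_eq J hcard
  refine ⟨M, ⟨false, hsemi⟩, ?_⟩
  -- the successor equation, curve by curve
  intro C hC
  cases C with
  | true => exact absurd rfl hC.1
  | false =>
    ext J
    constructor
    · -- (⊆): the only double-covering subgroup is `Π_D = 1`, open of index 2, trivially torsion-free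
      rintro ⟨D, f', -, -, hdeg', rfl⟩
      cases D with
      | false => exact absurd f'.down.1 Bool.false_ne_true
      | true =>
        have hf' : f' = f := Subsingleton.elim _ _
        subst hf'
        have hopen : IsOpen (M.arithImage f : Set (M.ext false).arith) := by
          rw [IsogenyModel.arithImage, MonoidHom.coe_range]
          exact (M.extMap_isOpenInjective f).isOpen_range_arith
        refine ⟨hopen, hdeg, fun y _ => Subtype.ext ?_⟩
        have hy : y.1 ∈ M.arithImage f := (Subgroup.mem_inf.mp y.2).1
        have hy' : y.1 ∈ (⊥ : Subgroup (M.ext false).arith) := hJ ▸ hy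
        exact Subgroup.mem_bot.mp hy'
    · -- (⊇): an index-2 subgroup of `ℤ/2` is `1 = Π_D`
      rintro ⟨-, hJ2, -⟩
      exact ⟨true, f, hover, ⟨rfl, rfl, rfl⟩, hdeg, (hidx2 J hJ2).trans hJ.symm⟩

/-! ### The successor output structure is inhabited -/

/-- **`EllipticCuspidalizationTF` is jointly satisfiable** (DEGENERATE finite toy, image under
`EllipticCuspidalization.toTF` of abc-iut's witness `EllipticCuspidalization.exists_nonempty_degenerate`:
`Π' = G' = ℤ/1`, core `ℤ/2 ↠ 1`, `Π_D = 1`).  Honest label: degenerate — not a cuspidalization of a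
curve. [cite: MochizukiAbsTopII2013, Cor 3.3 pp.67-69] -/
theorem EllipticCuspidalizationTF.exists_nonempty_degenerate :
    ∃ E : FundamentalExtension.{0}, Subsingleton E.arith ∧ Nonempty (EllipticCuspidalizationTF E) := by
  obtain ⟨E, hE, ⟨K⟩⟩ := EllipticCuspidalization.exists_nonempty_degenerate
  exact ⟨E, hE, ⟨K.toTF⟩⟩

end Literature.AnabelianGeometry.AbsoluteAnabelian.AbsTopII
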